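import Literature.Analysis.FluidPDE.AncientWeakL3BackwardLiouvilleHolds
import Literature.Analysis.FluidPDE.OseenMildUniqueness
import Literature.Analysis.UnboundedOperators.HeatKernelHeatEquation
import Summits.NavierStokesRegularity.NavierStokesRegularity.Theorems.TypeILiouvilleTypeIliouvilleLStubOseenConstBoost
import HarnessLib

/-!
# Weak-`L³` recurrence to a uniform stream in the far past (crux `TypeIliouvilleL`,
# stmt-NavierStokesRegularity-10661, persistent stub S3ᵐ): the `O(|x|⁻¹)`-wake currency

Helper file (theorems only, no definition, no named fact, no `sorry`; lands
`--supports stmt-NavierStokesRegularity-10661`). Companion of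
`TypeILiouvilleTypeIliouvilleLPersistentLpRecurrence` (`Lᵖ` recurrence, `0 < p ≤ 3`): the critical
LORENTZ class `L^{3,∞}` — which, unlike every `Lᵖ` with `p ≤ 3`, contains the wake shape
`uniform stream + O(|x|⁻¹)` of steady exterior flows and the tails of Type-I / self-similar profiles —
is reached through Albritton–Barker 2019, **Thm 4.1** (the tree's PROVED fact
`Literature.Analysis.FluidPDE.AlbrittonBarker2019_liouville_weakL3_backward_holds`, case `ε = 0`),
transported to a non-zero constant drift `b` by the constant Galilean boost
`w(t,y) = v(t, y + t•b) − b` (`stub_oseen_const_boost`).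

* `oseenMild_const_of_backward_weakL3_const` — a mild bounded ancient solution `v` (print's class)
  with a UNIFORM WEAK-`L³` bound `s³·vol{x : s < |v(τ_k,x) − b|} ≤ M < ∞` (all `s > 0`) along
  negative times `τ_k → −∞`, whose slice `v(t₀) − b` at one time `t₀ < 0` lies in Albritton–Barker's
  class `𝔹` — heat form (a) `√σ ‖e^{σΔ}(v(t₀) − b)‖_∞ ≤ A` and blow-down (b)
  `λ (v(t₀) − b)(λx + t₀b) ⇀ 0` as `λ → ∞` (stated on the Galilean translate by `t₀b`, which is what
  the boost sees) — equals `b` for all `t ≤ t₀`;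
* `oseenMild_const_of_backward_weakL3_const'` — the same with (b) assumed for every translate
  (`𝔹` is translation invariant in print; not re-proved here).

Transport facts used: translation invariance of Lebesgue measure for the distribution function
(`measure_preimage_add_right`) and of the caloric extension
(`heatExtension_comp_add_right_apply`). Compared with the `Lᵖ` file no slice condition can be
dropped: (b) fails for `−1`-homogeneous tails, which are in `L^{3,∞}` (Albritton–Barker's `ε(M)`).
Nothing here proves S3ᵐ, (L), or anything about Navier–Stokes regularity.
-/

set_option linter.dupNamespace false

namespace Summit.NavierStokesRegularity.NavierStokesRegularity.Theorems

open MeasureTheory Filter Set Function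
open scoped ENNReal NNReal Topology RealInnerProductSpace
open Literature.Analysis Literature.Analysis.FluidPDE

/-- **Backward weak-`L³` recurrence to one uniform stream, with the final slice in `𝔹`, kills a mild
bounded ancient solution up to that slice.** Let `v` be continuous and uniformly bounded on
`(−∞,0) × ℝ³`, weakly divergence free on every slice and Oseen-mild. Suppose that for a constant
vector `b` there are negative times `τ_k → −∞` and a finite `M` with
`s³ · vol{x : s < ‖v(τ_k,x) − b‖} ≤ M` for all `s > 0` and all `k` (uniform weak-`L³` bound of
`v(τ_k) − b`), and that at some `t₀ < 0`: (a) `√σ · ‖e^{σΔ}(v(t₀) − b)(x)‖ ≤ A` for all `σ > 0` and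
all `x`; (b) `∫ ⟪λ (v(t₀)(λx + t₀b) − b), φ(x)⟫ dx → 0` as `λ → ∞` for every smooth compactly
supported `φ`. Then `v(t,x) = b` for all `t ≤ t₀` and all `x`. Proof: the boost
`w(t,y) = v(t, y + t•b) − b` is a mild bounded ancient solution (`stub_oseen_const_boost`) with the
same distribution functions along `τ_k` (translation invariance of Lebesgue measure), whose slice
`w(t₀) = (v(t₀) − b)(· + t₀b)` satisfies Albritton–Barker's (a) (translation covariance of the
caloric extension) and (b) (verbatim); Thm 4.1 gives `w ≡ 0` on `t ≤ t₀`.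
[cite: AlbrittonBarker2019, Thm 4.1 (arXiv:1811.00502 §4 p. 9)] -/
theorem oseenMild_const_of_backward_weakL3_const
    (v : ℝ → EuclideanSpace ℝ (Fin 3) → EuclideanSpace ℝ (Fin 3)) (b : EuclideanSpace ℝ (Fin 3))
    (hvc : ContinuousOn (uncurry v) (Iio 0 ×ˢ univ))
    (hvK : ∃ K : ℝ, ∀ t < 0, ∀ x, ‖v t x‖ ≤ K)
    (hvd : ∀ t < 0, IsWeaklyDivFree (v t))
    (hvm : ∀ s t : ℝ, s < t → t < 0 → ∀ x,
      v t x = UnboundedOperators.heatExtension (v s) (t - s) x - oseenDuhamel 1 s v v t x)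
    (hwk : ∃ (τ : ℕ → ℝ) (M : ℝ≥0∞), M < ∞ ∧ Tendsto τ atTop atBot ∧ (∀ k, τ k < 0) ∧
      ∀ (k : ℕ) (s : ℝ), 0 < s →
        ENNReal.ofReal s ^ 3 *
          (volume : Measure (EuclideanSpace ℝ (Fin 3))) {x | s < ‖v (τ k) x - b‖} ≤ M)
    {t₀ : ℝ} (ht₀ : t₀ < 0)
    (hA : ∃ A : ℝ, ∀ σ : ℝ, 0 < σ → ∀ x,
      Real.sqrt σ * ‖UnboundedOperators.heatExtension (fun y => v t₀ y - b) σ x‖ ≤ A)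
    (hB : ∀ φ : EuclideanSpace ℝ (Fin 3) → EuclideanSpace ℝ (Fin 3),
      FunctionSpaces.IsTestFunctionOn (⊤ : TopologicalSpace.Opens (EuclideanSpace ℝ (Fin 3))) φ →
      Tendsto (fun lam : ℝ => ∫ x, ⟪lam • (v t₀ (lam • x + t₀ • b) - b), φ x⟫) atTop (𝓝 0)) :
    ∀ t : ℝ, t ≤ t₀ → ∀ x, v t x = b := by
  obtain ⟨τ, M, hM, hτlim, hτ0, hwk⟩ := hwk
  obtain ⟨A, hA⟩ := hA
  -- the boosted field
  set w : ℝ → EuclideanSpace ℝ (Fin 3) → EuclideanSpace ℝ (Fin 3) := fun t y => v t (y + t • b) - b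
    with hw_def
  obtain ⟨hwc, hwK, hwd, hwm⟩ := stub_oseen_const_boost v b hvc hvK hvd hvm
  -- weak-`L³` bounds of `w` along `τ k`: translation invariance of Lebesgue measure
  have hwk' : ∀ (k : ℕ) (s : ℝ), 0 < s →
      ENNReal.ofReal s ^ 3 * (volume : Measure (EuclideanSpace ℝ (Fin 3))) {x | s < ‖w (τ k) x‖} ≤ M := by
    intro k s hs
    have hset : {x | s < ‖w (τ k) x‖} =
        (fun x => x + τ k • b) ⁻¹' {y | s < ‖v (τ k) y - b‖} := rfl
    rw [hset, measure_preimage_add_right]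
    exact hwk k s hs
  -- (a) for the slice `w t₀ = (v t₀ − b)(· + t₀ • b)`
  have hA' : ∃ A : ℝ, ∀ σ : ℝ, 0 < σ → ∀ x,
      Real.sqrt σ * ‖UnboundedOperators.heatExtension (w t₀) σ x‖ ≤ A := by
    refine ⟨A, fun σ hσ x => ?_⟩
    have h1 : UnboundedOperators.heatExtension (w t₀) σ x =
        UnboundedOperators.heatExtension (fun y => v t₀ y - b) σ (x + t₀ • b) :=
      heatExtension_comp_add_right_apply (fun y => v t₀ y - b) (t₀ • b) σ x
    rw [h1]
    exact hA σ hσ (x + t₀ • b)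
  -- (b) for the slice `w t₀` is hypothesis `hB` verbatim
  have hB' : ∀ φ : EuclideanSpace ℝ (Fin 3) → EuclideanSpace ℝ (Fin 3),
      FunctionSpaces.IsTestFunctionOn (⊤ : TopologicalSpace.Opens (EuclideanSpace ℝ (Fin 3))) φ →
      Tendsto (fun lam : ℝ => ∫ x, ⟪lam • w t₀ (lam • x), φ x⟫) atTop (𝓝 0) := fun φ hφ => hB φ hφ
  -- Albritton–Barker Thm 4.1: `w ≡ 0` on `t ≤ t₀`
  have hw0 : ∀ t : ℝ, t ≤ t₀ → ∀ x, w t x = 0 :=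
    AlbrittonBarker2019_liouville_weakL3_backward_holds hwc hwK hwd hwm
      ⟨τ, M, hM, hτlim, hτ0, hwk'⟩ ht₀ hA' hB'
  intro t ht z
  have h := hw0 t ht (z - t • b)
  simp only [hw_def, sub_add_cancel, sub_eq_zero] at h
  exact h

/-- **Variant with the blow-down condition (b) assumed for every translate** of the slice
`v(t₀) − b` (in print `𝔹` is translation invariant; the boost needs the translate by `t₀b`).
[cite: AlbrittonBarker2019, Thm 4.1 (arXiv:1811.00502 §4 p. 9)] -/
theorem oseenMild_const_of_backward_weakL3_const'
    (v : ℝ → EuclideanSpace ℝ (Fin 3) → EuclideanSpace ℝ (Fin 3)) (b : EuclideanSpace ℝ (Fin 3))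
    (hvc : ContinuousOn (uncurry v) (Iio 0 ×ˢ univ))
    (hvK : ∃ K : ℝ, ∀ t < 0, ∀ x, ‖v t x‖ ≤ K)
    (hvd : ∀ t < 0, IsWeaklyDivFree (v t))
    (hvm : ∀ s t : ℝ, s < t → t < 0 → ∀ x,
      v t x = UnboundedOperators.heatExtension (v s) (t - s) x - oseenDuhamel 1 s v v t x)
    (hwk : ∃ (τ : ℕ → ℝ) (M : ℝ≥0∞), M < ∞ ∧ Tendsto τ atTop atBot ∧ (∀ k, τ k < 0) ∧
      ∀ (k : ℕ) (s : ℝ), 0 < s →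
        ENNReal.ofReal s ^ 3 *
          (volume : Measure (EuclideanSpace ℝ (Fin 3))) {x | s < ‖v (τ k) x - b‖} ≤ M)
    {t₀ : ℝ} (ht₀ : t₀ < 0)
    (hA : ∃ A : ℝ, ∀ σ : ℝ, 0 < σ → ∀ x,
      Real.sqrt σ * ‖UnboundedOperators.heatExtension (fun y => v t₀ y - b) σ x‖ ≤ A)
    (hB : ∀ (a : EuclideanSpace ℝ (Fin 3)) (φ : EuclideanSpace ℝ (Fin 3) → EuclideanSpace ℝ (Fin 3)),
      FunctionSpaces.IsTestFunctionOn (⊤ : TopologicalSpace.Opens (EuclideanSpace ℝ (Fin 3))) φ →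
      Tendsto (fun lam : ℝ => ∫ x, ⟪lam • (v t₀ (lam • x + a) - b), φ x⟫) atTop (𝓝 0)) :
    ∀ t : ℝ, t ≤ t₀ → ∀ x, v t x = b :=
  oseenMild_const_of_backward_weakL3_const v b hvc hvK hvd hvm hwk ht₀ hA (hB (t₀ • b))


/-- **Forward uniqueness from a zero slice in print's continuous mild class.** A field `w`,
continuous and uniformly bounded on `(−∞,0) × ℝ³` and Oseen-mild there, which vanishes at a time
`s₁ < 0`, vanishes at every later negative time: from the zero slice both `w` and `0` solve
`u(t) = −B¹_{s₁}(u,u)(t)` on `(s₁,0)`, and bounded solutions of the Oseen integral equation are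
unique (`oseenMild_bounded_unique`, KNSS 2009 §4 (4.3)–(4.4)); continuity of the slices upgrades
a.e. equality to equality. (The tree's `BoundedEnvelope.eq_zero_after_of_slice_eq_zero` is the
same statement for jointly smooth fields.) [cite: KochNadirashviliSereginSverak2009, §4 (4.3)–(4.4) (arXiv:0709.3599 p. 8)] -/
theorem oseenMild_eq_zero_after_of_slice_eq_zero
    {w : ℝ → EuclideanSpace ℝ (Fin 3) → EuclideanSpace ℝ (Fin 3)}
    (hwc : ContinuousOn (uncurry w) (Iio 0 ×ˢ univ))
    (hwK : ∃ K : ℝ, ∀ t < 0, ∀ x, ‖w t x‖ ≤ K)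
    (hwm : ∀ s t : ℝ, s < t → t < 0 → ∀ x,
      w t x = UnboundedOperators.heatExtension (w s) (t - s) x - oseenDuhamel 1 s w w t x)
    {s₁ : ℝ} (hzero : ∀ x, w s₁ x = 0) :
    ∀ t ∈ Ioo s₁ 0, ∀ x, w t x = 0 := by
  obtain ⟨B, hB⟩ := hwK
  have hM : 0 ≤ max B 0 := le_max_right _ _
  have hws₁ : w s₁ = fun _ => (0 : EuclideanSpace ℝ (Fin 3)) := funext hzero
  have hU : ∀ t x, UnboundedOperators.heatExtension (w s₁) (t - s₁) x = 0 := fun t x => by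
    rw [hws₁, UnboundedOperators.heatExtension_zero_fun]; rfl
  have hcont : ContinuousOn (uncurry w) (Ioo s₁ 0 ×ˢ univ) :=
    hwc.mono (prod_mono Ioo_subset_Iio_self Subset.rfl)
  have hum : AEStronglyMeasurable (uncurry w)
      ((volume : Measure (ℝ × EuclideanSpace ℝ (Fin 3))).restrict (Ioo s₁ 0 ×ˢ univ)) :=
    hcont.aestronglyMeasurable (measurableSet_Ioo.prod MeasurableSet.univ)
  have hzm : AEStronglyMeasurable
      (uncurry (0 : ℝ → EuclideanSpace ℝ (Fin 3) → EuclideanSpace ℝ (Fin 3)))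
      ((volume : Measure (ℝ × EuclideanSpace ℝ (Fin 3))).restrict (Ioo s₁ 0 ×ˢ univ)) :=
    aestronglyMeasurable_const
  have huniq := oseenMild_bounded_unique (E := EuclideanSpace ℝ (Fin 3)) (ν := 1) (s := s₁) (T := 0)
    (u := w) (v := 0) (U := fun t x => UnboundedOperators.heatExtension (w s₁) (t - s₁) x)
    one_pos hM hum hzm
    (fun τ hτ y => (hB τ hτ.2 y).trans (le_max_left _ _))
    (fun τ _ y => by simp [hM])
    (fun t ht => Eventually.of_forall fun x => hwm s₁ t ht.1 ht.2 x)
    (fun t _ => Eventually.of_forall fun x => by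
      simp only [oseenDuhamel_zero_left, hU, Pi.zero_apply, sub_self])
  intro t ht x
  have hae : w t =ᵐ[volume] (0 : ℝ → EuclideanSpace ℝ (Fin 3) → EuclideanSpace ℝ (Fin 3)) t :=
    huniq t ht
  have hct : Continuous (w t) :=
    hwc.comp_continuous (continuous_const.prodMk continuous_id) fun y => ⟨ht.2, mem_univ y⟩
  have heq : w t = (0 : ℝ → EuclideanSpace ℝ (Fin 3) → EuclideanSpace ℝ (Fin 3)) t :=
    (Continuous.ae_eq_iff_eq volume hct continuous_const).1 hae
  rw [heq]; rfl

/-- **Weak-`L³` recurrence with the slice condition at `t₀`: the conclusion on the whole slab.**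
Under the hypotheses of `oseenMild_const_of_backward_weakL3_const`, `v ≡ b` also for
`t₀ < t < 0` (forward uniqueness of the boosted field from its zero slice at `t₀`,
`oseenMild_eq_zero_after_of_slice_eq_zero`). [cite: AlbrittonBarker2019, Thm 4.1 (arXiv:1811.00502 §4 p. 9)] -/
theorem oseenMild_const_of_backward_weakL3_const_slab
    (v : ℝ → EuclideanSpace ℝ (Fin 3) → EuclideanSpace ℝ (Fin 3)) (b : EuclideanSpace ℝ (Fin 3))
    (hvc : ContinuousOn (uncurry v) (Iio 0 ×ˢ univ))
    (hvK : ∃ K : ℝ, ∀ t < 0, ∀ x, ‖v t x‖ ≤ K)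
    (hvd : ∀ t < 0, IsWeaklyDivFree (v t))
    (hvm : ∀ s t : ℝ, s < t → t < 0 → ∀ x,
      v t x = UnboundedOperators.heatExtension (v s) (t - s) x - oseenDuhamel 1 s v v t x)
    (hwk : ∃ (τ : ℕ → ℝ) (M : ℝ≥0∞), M < ∞ ∧ Tendsto τ atTop atBot ∧ (∀ k, τ k < 0) ∧
      ∀ (k : ℕ) (s : ℝ), 0 < s →
        ENNReal.ofReal s ^ 3 *
          (volume : Measure (EuclideanSpace ℝ (Fin 3))) {x | s < ‖v (τ k) x - b‖} ≤ M)
    {t₀ : ℝ} (ht₀ : t₀ < 0)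
    (hA : ∃ A : ℝ, ∀ σ : ℝ, 0 < σ → ∀ x,
      Real.sqrt σ * ‖UnboundedOperators.heatExtension (fun y => v t₀ y - b) σ x‖ ≤ A)
    (hB : ∀ φ : EuclideanSpace ℝ (Fin 3) → EuclideanSpace ℝ (Fin 3),
      FunctionSpaces.IsTestFunctionOn (⊤ : TopologicalSpace.Opens (EuclideanSpace ℝ (Fin 3))) φ →
      Tendsto (fun lam : ℝ => ∫ x, ⟪lam • (v t₀ (lam • x + t₀ • b) - b), φ x⟫) atTop (𝓝 0)) :
    ∀ t < 0, ∀ x, v t x = b := by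
  have hpast := oseenMild_const_of_backward_weakL3_const v b hvc hvK hvd hvm hwk ht₀ hA hB
  -- the boosted field vanishes at `t₀`, hence afterwards
  set w : ℝ → EuclideanSpace ℝ (Fin 3) → EuclideanSpace ℝ (Fin 3) := fun t y => v t (y + t • b) - b
    with hw_def
  obtain ⟨hwc, hwK, _, hwm⟩ := stub_oseen_const_boost v b hvc hvK hvd hvm
  have hw0 : ∀ x, w t₀ x = 0 := fun x => by
    simp only [hw_def, hpast t₀ le_rfl, sub_self]
  have hafter := oseenMild_eq_zero_after_of_slice_eq_zero hwc hwK hwm hw0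
  intro t ht z
  rcases le_or_gt t t₀ with hle | hgt
  · exact hpast t hle z
  · have h := hafter t ⟨hgt, ht⟩ (z - t • b)
    simp only [sub_add_cancel, sub_eq_zero] at h
    exact h

end Summit.NavierStokesRegularity.NavierStokesRegularity.Theorems
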